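import Literature.Analysis.FluidPDE.TorusWordEnergy
import Literature.Analysis.FluidPDE.TorusWordSpaceTime
import Literature.Analysis.FluidPDE.TorusClassicalHnBalance
import Literature.Analysis.FluidPDE.CompressibleEulerLinearizedDerivative
import Literature.Analysis.FunctionSpaces.TorusEnstrophyTrilinear
import Summits.AnomalousDissipation.AnomalousDissipation.Theorems.MarginalStabilityChainChainRealisationStubUniformGronwall
import HarnessLib

/-!
# Stub `stub_sobolevBootstrap` of the line `SketchIdeator2` (card `separatrix-flux-pinning`), helper file A
# (crux `MarginalStabilityChain.ChainRealisation`, stmt-AnomalousDissipation-14249)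

Helper file (everything proved; theorems only) for the sorry-free discharge of the registered stub
`stub_sobolevBootstrap` (B2, the all-order Sobolev bootstrap of a forward classical Navier–Stokes
solution on `T³`) in `…StubSobolevBootstrap.lean`.  It supplies, for classical solutions on a slab
`[a, b] × T^d` and the word/Sobolev energies `wordEnergy`, `sobolevEnergy` of `TorusWordEnergy`:

* `sobolev_aux_isDivFree_wordDeriv`, `sobolev_aux_wordDeriv_laplacian` — word derivatives of smooth
  solenoidal fields are solenoidal, and `∂^w` commutes with `Δ` (with `∇`: inside the word balance, from
  `CompressibleEuler.partialDeriv_gradient_eq`);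
* `sobolev_aux_wordEnergy_one/two/three`, `sobolev_aux_sum_gradNormSq_wordDeriv` — `E_1 = ‖∇·‖₂²`,
  `E_2 = ‖Δ·‖₂²`, `E_3 = ‖∇Δ·‖₂²`, `∑_{|v| ≤ m} ‖∇∂^v f‖₂² + ‖f‖₂² = E_{m+1}(f)` (as sums over all ordered words);
* `sobolev_aux_continuousOn_wordEnergy/sobolevEnergy`, `sobolev_aux_exists_bound_Icc` — time continuity
  of the energies of a jointly smooth field, hence bounds on compact time intervals;
* `sobolev_aux_hasDerivWithinAt_wordDeriv` — the **word balance** of classical Navier–Stokes solutions,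
  `d/dt ½∫‖∂^w u‖² = −ν‖∇∂^w u‖₂² − ∫⟪∂^w((u·∇)u), ∂^w u⟫ + ∫⟪∂^w f, ∂^w u⟫` within `[a, b]` (pattern of
  `TorusClassicalHnBalance`: differentiate under the integral, `∂ₜ∂^w = ∂^w∂ₜ`, momentum equation along
  `w`, Green, and the pressure drops because `∂^w u` is solenoidal), its explicit `T³` form
  `sobolev_aux_wordBalance` (the registered helper statement), and its sum over `|w| ≤ m`,
  `sobolev_aux_hasDerivWithinAt_sobolevEnergy` (Majda–Bertozzi 2002, Prop. 3.7; FMRT 2001, Ch. II App. A);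
* `sobolev_aux_sum_integral_inner_wordDeriv_le` — the force term `∑ ∫⟪∂^v Φ, ∂^v f⟫ ≤ ½(E_m(Φ) + E_m(f))`;
* `sobolev_aux_integral_le_of_deriv_le` — real analysis: a right-derivative inequality
  `Y' ≤ −ν G + K` with `Y ≥ 0` gives the sliding integral bound `ν ∫ₜ^{t+1} G ≤ Y(t) + K` (fencing theorem).

References: C. Foias, O. Manley, R. Rosa, R. Temam, *Navier–Stokes Equations and Turbulence*, CUP 2001,
Ch. II App. A §A.4–A.5; P. Constantin, C. Foias, *Navier–Stokes Equations*, 1988, Ch. 13;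
A. J. Majda, A. L. Bertozzi, *Vorticity and Incompressible Flow*, CUP 2002, Prop. 3.7.
-/

set_option linter.dupNamespace false

noncomputable section

open MeasureTheory Set Filter Topology
open scoped InnerProductSpace
open Literature.Analysis.FunctionSpaces Literature.Analysis.FunctionSpaces.Torus
open Literature.Analysis.FluidPDE
open Literature.Analysis.FluidPDE.Torus

namespace Summit.AnomalousDissipation.AnomalousDissipation.Theorems.ChainRealisation.SeparatrixFluxPinning

/-- Local notation: the torus `T³`. -/
local notation "𝕋³" => UnitAddTorus (Fin 3)
/-- Local notation: velocity values. -/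
local notation "E³" => EuclideanSpace ℝ (Fin 3)

variable {d : Type*} [Fintype d] [DecidableEq d]
variable {F' : Type*} [NormedAddCommGroup F'] [NormedSpace ℝ F']

/-! ## Word derivatives of solenoidal fields; `∂^w` through the Laplacian -/

/-- Word derivatives of a smooth divergence-free field are divergence free (`div ∂ⱼ = ∂ⱼ div`,
`CompressibleEuler.partialDeriv_divergence_eq`, letter by letter). -/
theorem sobolev_aux_isDivFree_wordDeriv {u : UnitAddTorus d → EuclideanSpace ℝ d} (hu : IsSmooth u)
    (hdiv : IsDivFree u) : ∀ w : List d, IsDivFree (wordDeriv w u)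
  | [] => hdiv
  | j :: w => by
      intro x
      have hw : IsSmooth (wordDeriv w u) := isSmooth_wordDeriv hu w
      rw [wordDeriv_cons, ← CompressibleEuler.partialDeriv_divergence_eq hw j x]
      have h0 : Torus.divergence (wordDeriv w u) = fun _ => (0 : ℝ) :=
        funext (sobolev_aux_isDivFree_wordDeriv hu hdiv w)
      rw [h0]
      simp [Torus.partialDeriv, Torus.lineDeriv]

/-- `∂^w Δf = Δ ∂^w f` for smooth `f`. -/
theorem sobolev_aux_wordDeriv_laplacian {f : UnitAddTorus d → F'} (hf : IsSmooth f) :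
    ∀ w : List d, wordDeriv w (Torus.laplacian f) = Torus.laplacian (wordDeriv w f)
  | [] => rfl
  | j :: w => by
      rw [wordDeriv_cons, wordDeriv_cons, sobolev_aux_wordDeriv_laplacian hf w]
      funext x
      exact partialDeriv_laplacian_comm (isSmooth_wordDeriv hf w) j x

/-! ## Word energies against `gradNormSq` and `‖Δ·‖₂²` -/

/-- `E_{n+1}(f) = ∑_{|v| = n} ‖∇∂^v f‖₂²`. -/
theorem sobolev_aux_wordEnergy_succ (n : ℕ) {f : UnitAddTorus d → EuclideanSpace ℝ d} (hf : IsSmooth f) :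
    wordEnergy (n + 1) f = ∑ v : Fin n → d, gradNormSq (wordDeriv (List.ofFn v) f) := by
  rw [wordEnergy_succ']
  refine Finset.sum_congr rfl fun v _ => ?_
  rw [gradNormSq]
  exact (integral_finsetSum _ fun i _ =>
    (((isSmooth_wordDeriv hf _).partialDeriv i).continuous.norm.pow 2).integrable_unitAddTorus).symm

/-- `E_{n+2}(f) = ∑_{|v| = n} ‖Δ∂^v f‖₂²`. -/
theorem sobolev_aux_wordEnergy_succ_succ (n : ℕ) {f : UnitAddTorus d → EuclideanSpace ℝ d} (hf : IsSmooth f) :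
    wordEnergy (n + 2) f = ∑ v : Fin n → d, ∫ x, ‖Torus.laplacian (wordDeriv (List.ofFn v) f) x‖ ^ 2 := by
  rw [sobolev_aux_wordEnergy_succ (n + 1) hf, ← (Fin.consEquiv fun _ : Fin (n + 1) => d).sum_comp,
    Fintype.sum_prod_type, Finset.sum_comm]
  refine Finset.sum_congr rfl fun v _ => ?_
  rw [← sum_gradNormSq_partialDeriv_eq (isSmooth_wordDeriv hf _)]
  refine Finset.sum_congr rfl fun j _ => ?_
  have : List.ofFn ((Fin.consEquiv fun _ : Fin (n + 1) => d) (j, v)) = j :: List.ofFn v := by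
    simp [Fin.consEquiv]
  rw [this, wordDeriv_cons]

/-- `E_1(f) = ‖∇f‖₂²`. -/
theorem sobolev_aux_wordEnergy_one {f : UnitAddTorus d → EuclideanSpace ℝ d} (hf : IsSmooth f) :
    wordEnergy 1 f = gradNormSq f := by
  rw [sobolev_aux_wordEnergy_succ 0 hf, Fintype.sum_unique]
  simp

/-- `E_2(f) = ‖Δf‖₂²`. -/
theorem sobolev_aux_wordEnergy_two {f : UnitAddTorus d → EuclideanSpace ℝ d} (hf : IsSmooth f) :
    wordEnergy 2 f = ∫ x, ‖Torus.laplacian f x‖ ^ 2 := by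
  rw [sobolev_aux_wordEnergy_succ_succ 0 hf, Fintype.sum_unique]
  simp

/-- `E_3(f) = ‖∇Δf‖₂²`. -/
theorem sobolev_aux_wordEnergy_three {f : UnitAddTorus d → EuclideanSpace ℝ d} (hf : IsSmooth f) :
    wordEnergy 3 f = gradNormSq (Torus.laplacian f) := by
  rw [sobolev_aux_wordEnergy_succ_succ 1 hf, ← (Fin.consEquiv fun _ : Fin 1 => d).sum_comp,
    Fintype.sum_prod_type, gradNormSq]
  rw [integral_finsetSum _ fun i _ => (hf.laplacian.partialDeriv i).norm_sq.integrable]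
  refine Finset.sum_congr rfl fun j _ => ?_
  rw [Fintype.sum_unique]
  have : List.ofFn ((Fin.consEquiv fun _ : Fin 1 => d) (j, default)) = [j] := by
    simp [Fin.consEquiv]
  rw [this, wordDeriv_singleton]
  refine integral_congr_ae (ae_of_all _ fun x => ?_)
  simp only
  rw [show Torus.laplacian (Torus.partialDeriv j f) x = Torus.partialDeriv j (Torus.laplacian f) x from
    (partialDeriv_laplacian_comm hf j x).symm]

/-- `∑_{n ≤ m} ∑_{|v| = n} ‖∇∂^v f‖₂² = E_{m+1}(f) − E_0(f)` (in the form `… + ∫‖f‖² = E_{m+1}(f)`). -/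
theorem sobolev_aux_sum_gradNormSq_wordDeriv (m : ℕ) {f : UnitAddTorus d → EuclideanSpace ℝ d} (hf : IsSmooth f) :
    ∑ n ∈ Finset.range (m + 1), ∑ v : Fin n → d, gradNormSq (wordDeriv (List.ofFn v) f) + ∫ x, ‖f x‖ ^ 2 =
      sobolevEnergy (m + 1) f := by
  rw [sobolevEnergy, Finset.sum_range_succ' (fun n => wordEnergy n f), wordEnergy_zero]
  congr 1
  exact Finset.sum_congr rfl fun n _ => (sobolev_aux_wordEnergy_succ n hf).symm

/-! ## Time continuity of the word and Sobolev energies of a jointly smooth field -/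

/-- For a jointly smooth `U` on `[0, ∞) × T^d`, `t ↦ E_n(U t)` (one word energy) is continuous on `[0, ∞)`
(space integrals of the jointly smooth `‖∂^v U‖²`, `IsSmoothSpaceTimeOn.continuousOn_integral`). -/
theorem sobolev_aux_continuousOn_wordEnergy {U : ℝ → UnitAddTorus d → EuclideanSpace ℝ d}
    (hU : Torus.IsSmoothSpaceTimeOn (Ici (0 : ℝ)) U) (n : ℕ) :
    ContinuousOn (fun t => wordEnergy n (U t)) (Ici (0 : ℝ)) := by
  have h1 : ∀ w : List d, ContinuousOn (fun t => ∫ x, ‖wordDeriv w (U t) x‖ ^ 2) (Ici (0 : ℝ)) := fun w => by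
    have h : Torus.IsSmoothSpaceTimeOn (Ici (0 : ℝ)) (fun t x => ‖wordDeriv w (U t) x‖ ^ 2) :=
      ContDiffOn.norm_sq ℝ (isSmoothSpaceTimeOn_wordDeriv hU (uniqueDiffOn_Ici 0) w)
    exact h.continuousOn_integral (convex_Ici 0)
  unfold wordEnergy
  exact continuousOn_finsetSum _ fun v _ => h1 _

/-- Hence `t ↦ E_k(U t)` (the Sobolev energy) is continuous on `[0, ∞)`. -/
theorem sobolev_aux_continuousOn_sobolevEnergy {U : ℝ → UnitAddTorus d → EuclideanSpace ℝ d}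
    (hU : Torus.IsSmoothSpaceTimeOn (Ici (0 : ℝ)) U) (k : ℕ) :
    ContinuousOn (fun t => sobolevEnergy k (U t)) (Ici (0 : ℝ)) := by
  unfold sobolevEnergy
  exact continuousOn_finsetSum _ fun n _ => sobolev_aux_continuousOn_wordEnergy hU n

/-- Hence `E_k(U t)` is bounded on every compact `[0, T]`. -/
theorem sobolev_aux_exists_bound_Icc {U : ℝ → UnitAddTorus d → EuclideanSpace ℝ d}
    (hU : Torus.IsSmoothSpaceTimeOn (Ici (0 : ℝ)) U) (k : ℕ) (T : ℝ) :
    ∃ C : ℝ, ∀ t ∈ Icc 0 T, sobolevEnergy k (U t) ≤ C := by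
  obtain ⟨C, hC⟩ := isCompact_Icc.exists_bound_of_continuousOn
    ((sobolev_aux_continuousOn_sobolevEnergy hU k).mono (Icc_subset_Ici_self : Icc 0 T ⊆ Ici 0))
  exact ⟨C, fun t ht => (le_abs_self _).trans ((Real.norm_eq_abs _).symm.le.trans (hC t ht))⟩

/-! ## The word balance of classical Navier–Stokes solutions -/

/-- **The word balance of classical Navier–Stokes solutions on the torus.** For a classical solution of
`∂ₜu + (u·∇)u = νΔu − ∇p + f`, `div u = 0` on `T^d × [a, b]`, `a < b`, every word `w` and every
`t ∈ [a, b]`,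
`d/dt ½ ∫ ‖∂^w u(t)‖² = −ν ‖∇∂^w u(t)‖₂² − ∫ ⟪∂^w((u·∇)u)(t), ∂^w u(t)⟫ + ∫ ⟪∂^w f(t), ∂^w u(t)⟫`
as a one-sided derivative within `[a, b]`: differentiate under the integral, commute `∂ₜ` with `∂^w`
(`timeDerivWithin_wordDeriv_comm`), insert the momentum equation differentiated along `w`, use
`∫ ⟪Δ∂^w u, ∂^w u⟫ = −‖∇∂^w u‖₂²`, and drop the pressure: `∂^w ∇p = ∇∂^w p` is `L²`-orthogonal to the
solenoidal field `∂^w u` (Majda–Bertozzi 2002, Prop. 3.7; FMRT 2001, Ch. II App. A). -/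
theorem sobolev_aux_hasDerivWithinAt_wordDeriv
    {a b ν : ℝ} {f u : ℝ → UnitAddTorus d → EuclideanSpace ℝ d} {p : ℝ → UnitAddTorus d → ℝ}
    (h : IsClassicalNSSolutionOn (Icc a b) ν f u p) (hab : a < b) (w : List d) {t : ℝ}
    (ht : t ∈ Icc a b) :
    HasDerivWithinAt (fun s => 2⁻¹ * ∫ x, ‖wordDeriv w (u s) x‖ ^ 2)
      (-ν * gradNormSq (wordDeriv w (u t)) -
        (∫ x, ⟪wordDeriv w (convect (u t) (u t)) x, wordDeriv w (u t) x⟫_ℝ) +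
        ∫ x, ⟪wordDeriv w (f t) x, wordDeriv w (u t) x⟫_ℝ) (Icc a b) t := by
  set S : Set ℝ := Icc a b with hSdef
  have hSc : Convex ℝ S := convex_Icc a b
  have hU : UniqueDiffOn ℝ S := uniqueDiffOn_Icc hab
  have hu : Torus.IsSmoothSpaceTimeOn S u := h.smooth_velocity
  have hut : IsSmooth (u t) := hu.isSmooth_slice ht
  have hpt : IsSmooth (p t) := h.smooth_pressure.isSmooth_slice ht
  have hA : IsSmooth (Torus.timeDerivWithin S u t) := hu.isSmooth_timeDerivWithin hU ht
  have hWst : Torus.IsSmoothSpaceTimeOn S (fun s => wordDeriv w (u s)) := isSmoothSpaceTimeOn_wordDeriv hu hU w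
  have hW : IsSmooth (wordDeriv w (u t)) := isSmooth_wordDeriv hut w
  -- Step 1: differentiate `½ ∫ ‖∂^w u‖²` under the integral sign.
  have hφ : Torus.IsSmoothSpaceTimeOn S (fun s x => ‖wordDeriv w (u s) x‖ ^ 2) := ContDiffOn.norm_sq ℝ hWst
  have hE : HasDerivWithinAt (fun s => 2⁻¹ * ∫ x, ‖wordDeriv w (u s) x‖ ^ 2)
      (2⁻¹ * ∫ x, Torus.timeDerivWithin S (fun s x => ‖wordDeriv w (u s) x‖ ^ 2) t x) S t :=
    (hφ.hasDerivWithinAt_integral hSc ht).const_mul 2⁻¹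
  -- Step 2: `∂ₜ ‖∂^w u‖² = 2 ⟪∂^w ∂ₜu, ∂^w u⟫`.
  have htd : ∀ x, Torus.timeDerivWithin S (fun s x => ‖wordDeriv w (u s) x‖ ^ 2) t x =
      2 * ⟪wordDeriv w (Torus.timeDerivWithin S u t) x, wordDeriv w (u t) x⟫_ℝ := by
    intro x
    have h1 := ((hWst.hasDerivWithinAt_slice ht x).norm_sq).derivWithin (hU t ht)
    rw [Torus.timeDerivWithin, h1, ← timeDerivWithin_wordDeriv_comm hab hu ht w x, real_inner_comm]
  have hE' : 2⁻¹ * ∫ x, Torus.timeDerivWithin S (fun s x => ‖wordDeriv w (u s) x‖ ^ 2) t x =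
      ∫ x, ⟪wordDeriv w (Torus.timeDerivWithin S u t) x, wordDeriv w (u t) x⟫_ℝ := by
    simp_rw [htd, integral_const_mul]
    ring
  rw [hE'] at hE
  convert hE using 1
  -- Step 3: insert the momentum equation, differentiated along `w`.
  have hΔ : IsSmooth (Torus.laplacian (u t)) := hut.laplacian
  have hC : IsSmooth (convect (u t) (u t)) := hut.convect hut
  have hG : IsSmooth (Torus.gradient (p t)) := hpt.gradient
  have hf : IsSmooth (f t) := by
    have hfun : f t = fun x => Torus.timeDerivWithin S u t x +
        convect (u t) (u t) x - ν • Torus.laplacian (u t) x + Torus.gradient (p t) x := by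
      funext x
      rw [h.momentum t ht x]
      abel
    rw [hfun]
    exact ((hA.add hC).sub (hΔ.smul ν)).add hG
  have hA_eq : Torus.timeDerivWithin S u t =
      ν • Torus.laplacian (u t) - Torus.gradient (p t) + f t - convect (u t) (u t) := by
    funext x
    simp only [Pi.add_apply, Pi.sub_apply, Pi.smul_apply]
    rw [← h.momentum t ht x]
    abel
  -- `∂^w ∇p = ∇ ∂^w p` (the tree's `Torus.wordDeriv_gradient_comm` of `TorusWordVectorCalculus`, re-derived
  -- letter by letter from `CompressibleEuler.partialDeriv_gradient_eq`)
  have hwg : ∀ w' : List d, wordDeriv w' (Torus.gradient (p t)) = Torus.gradient (wordDeriv w' (p t)) := by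
    intro w'
    induction w' with
    | nil => rfl
    | cons j w' ih =>
        rw [wordDeriv_cons, wordDeriv_cons, ih]
        funext x
        exact CompressibleEuler.partialDeriv_gradient_eq (isSmooth_wordDeriv hpt w') j x
  have hwA : wordDeriv w (Torus.timeDerivWithin S u t) =
      ν • Torus.laplacian (wordDeriv w (u t)) - Torus.gradient (wordDeriv w (p t)) + wordDeriv w (f t) -
        wordDeriv w (convect (u t) (u t)) := by
    rw [hA_eq, wordDeriv_sub (((hΔ.smul ν).sub hG).add hf) hC, wordDeriv_add ((hΔ.smul ν).sub hG) hf,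
      wordDeriv_sub (hΔ.smul ν) hG, wordDeriv_const_smul hΔ ν, sobolev_aux_wordDeriv_laplacian hut w, hwg w]
  have hWΔ : IsSmooth (Torus.laplacian (wordDeriv w (u t))) := hW.laplacian
  have hWp : IsSmooth (wordDeriv w (p t)) := isSmooth_wordDeriv hpt w
  have hWf : IsSmooth (wordDeriv w (f t)) := isSmooth_wordDeriv hf w
  have hWC : IsSmooth (wordDeriv w (convect (u t) (u t))) := isSmooth_wordDeriv hC w
  have iL : Integrable (fun x => ⟪(ν • Torus.laplacian (wordDeriv w (u t))) x, wordDeriv w (u t) x⟫_ℝ) volume :=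
    ((hWΔ.smul ν).inner hW).integrable
  have iG : Integrable (fun x => ⟪Torus.gradient (wordDeriv w (p t)) x, wordDeriv w (u t) x⟫_ℝ) volume :=
    (hWp.gradient.inner hW).integrable
  have iF : Integrable (fun x => ⟪wordDeriv w (f t) x, wordDeriv w (u t) x⟫_ℝ) volume :=
    (hWf.inner hW).integrable
  have iC : Integrable (fun x => ⟪wordDeriv w (convect (u t) (u t)) x, wordDeriv w (u t) x⟫_ℝ) volume :=
    (hWC.inner hW).integrable
  have hsplit : ∫ x, ⟪wordDeriv w (Torus.timeDerivWithin S u t) x, wordDeriv w (u t) x⟫_ℝ =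
      (∫ x, ⟪(ν • Torus.laplacian (wordDeriv w (u t))) x, wordDeriv w (u t) x⟫_ℝ) -
        (∫ x, ⟪Torus.gradient (wordDeriv w (p t)) x, wordDeriv w (u t) x⟫_ℝ) +
        (∫ x, ⟪wordDeriv w (f t) x, wordDeriv w (u t) x⟫_ℝ) -
        ∫ x, ⟪wordDeriv w (convect (u t) (u t)) x, wordDeriv w (u t) x⟫_ℝ := by
    rw [hwA]
    simp_rw [Pi.sub_apply, Pi.add_apply, Pi.sub_apply, inner_sub_left, inner_add_left, inner_sub_left]
    rw [integral_sub ?_ iC, integral_add ?_ iF, integral_sub iL iG]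
    · exact iL.sub iG
    · exact (iL.sub iG).add iF
  -- the viscous term and the pressure term
  have hvisc : ∫ x, ⟪(ν • Torus.laplacian (wordDeriv w (u t))) x, wordDeriv w (u t) x⟫_ℝ =
      -ν * gradNormSq (wordDeriv w (u t)) := by
    simp_rw [Pi.smul_apply, real_inner_smul_left, integral_const_mul]
    rw [integral_inner_laplacian_self_eq_neg_gradNormSq hW]
    ring
  have hpres : ∫ x, ⟪Torus.gradient (wordDeriv w (p t)) x, wordDeriv w (u t) x⟫_ℝ = 0 :=
    integral_inner_gradient_eq_zero_of_isDivFree hW hWp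
      (sobolev_aux_isDivFree_wordDeriv hut (h.divFree t ht) w)
  rw [hsplit, hvisc, hpres]
  ring

/-- **The `H^m` balance**: summing the word balances over all words of length `≤ m`,
`d/dt ½ E_m(u(t)) = ∑_{n ≤ m} ∑_{|v| = n} (−ν ‖∇∂^v u‖₂² − ∫ ⟪∂^v((u·∇)u), ∂^v u⟫ + ∫ ⟪∂^v f, ∂^v u⟫)`
within `[a, b]`. -/
theorem sobolev_aux_hasDerivWithinAt_sobolevEnergy
    {a b ν : ℝ} {f u : ℝ → UnitAddTorus d → EuclideanSpace ℝ d} {p : ℝ → UnitAddTorus d → ℝ}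
    (h : IsClassicalNSSolutionOn (Icc a b) ν f u p) (hab : a < b) (m : ℕ) {t : ℝ}
    (ht : t ∈ Icc a b) :
    HasDerivWithinAt (fun s => 2⁻¹ * sobolevEnergy m (u s))
      (∑ n ∈ Finset.range (m + 1), ∑ v : Fin n → d,
        (-ν * gradNormSq (wordDeriv (List.ofFn v) (u t)) -
          (∫ x, ⟪wordDeriv (List.ofFn v) (convect (u t) (u t)) x, wordDeriv (List.ofFn v) (u t) x⟫_ℝ) +
          ∫ x, ⟪wordDeriv (List.ofFn v) (f t) x, wordDeriv (List.ofFn v) (u t) x⟫_ℝ)) (Icc a b) t := by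
  have hfun : (fun s => 2⁻¹ * sobolevEnergy m (u s)) = fun s => ∑ n ∈ Finset.range (m + 1), ∑ v : Fin n → d,
      2⁻¹ * ∫ x, ‖wordDeriv (List.ofFn v) (u s) x‖ ^ 2 := by
    funext s
    simp only [sobolevEnergy, wordEnergy, Finset.mul_sum]
  rw [hfun]
  exact HasDerivWithinAt.fun_sum fun n _ => HasDerivWithinAt.fun_sum fun v _ =>
    sobolev_aux_hasDerivWithinAt_wordDeriv h hab (List.ofFn v) ht

/-- **The word balance on `T³`, explicit form** (registered helper statement of this file): for a classical
solution of the forced Navier–Stokes system on `[a, b] × T³`, `a < b`, every word `w` over `Fin 3` and every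
`t ∈ [a, b]`, `d/dt ½∫‖∂^w u‖² = −ν‖∇∂^w u‖₂² − ∫⟪∂^w((u·∇)u), ∂^w u⟫ + ∫⟪∂^w f, ∂^w u⟫` within `[a, b]`. -/
theorem sobolev_aux_wordBalance : ∀ (a b ν : ℝ) (f u : ℝ → 𝕋³ → E³) (p : ℝ → 𝕋³ → ℝ), IsClassicalNSSolutionOn (Icc a b) ν f u p → a < b → ∀ (w : List (Fin 3)) (t : ℝ), t ∈ Icc a b → HasDerivWithinAt (fun s => 2⁻¹ * ∫ x, ‖wordDeriv w (u s) x‖ ^ 2) (-ν * gradNormSq (wordDeriv w (u t)) - (∫ x, ⟪wordDeriv w (convect (u t) (u t)) x, wordDeriv w (u t) x⟫_ℝ) + ∫ x, ⟪wordDeriv w (f t) x, wordDeriv w (u t) x⟫_ℝ) (Icc a b) t :=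
  fun _ _ _ _ _ _ h hab w _ ht => sobolev_aux_hasDerivWithinAt_wordDeriv h hab w ht

/-! ## The force term -/

omit [DecidableEq d] in
/-- `∫ ⟪a, b⟫ ≤ ½ (‖a‖₂² + ‖b‖₂²)` for smooth fields (pointwise `2⟪a, b⟫ ≤ ‖a‖² + ‖b‖²`). -/
theorem sobolev_aux_integral_inner_le {G : Type*} [NormedAddCommGroup G] [InnerProductSpace ℝ G]
    {a b : UnitAddTorus d → G} (ha : IsSmooth a) (hb : IsSmooth b) :
    ∫ x, ⟪a x, b x⟫_ℝ ≤ 2⁻¹ * ((∫ x, ‖a x‖ ^ 2) + ∫ x, ‖b x‖ ^ 2) := by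
  rw [← integral_add ha.norm_sq.integrable hb.norm_sq.integrable, ← integral_const_mul]
  refine integral_mono (ha.inner hb).integrable
    ((ha.norm_sq.integrable.add hb.norm_sq.integrable).const_mul _) fun x => ?_
  have h1 : ⟪a x, b x⟫_ℝ ≤ ‖a x‖ * ‖b x‖ := real_inner_le_norm _ _
  have h2 := two_mul_le_add_sq ‖a x‖ ‖b x‖
  show ⟪a x, b x⟫_ℝ ≤ 2⁻¹ * (‖a x‖ ^ 2 + ‖b x‖ ^ 2)
  linarith

/-- The force term of the `H^m` balance: `∑_{|v| ≤ m} ∫ ⟪∂^v Φ, ∂^v f⟫ ≤ ½ (E_m(Φ) + E_m(f))`. -/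
theorem sobolev_aux_sum_integral_inner_wordDeriv_le {G : Type*} [NormedAddCommGroup G] [InnerProductSpace ℝ G]
    (m : ℕ) {Φ f : UnitAddTorus d → G} (hΦ : IsSmooth Φ) (hf : IsSmooth f) :
    ∑ n ∈ Finset.range (m + 1), ∑ v : Fin n → d,
        ∫ x, ⟪wordDeriv (List.ofFn v) Φ x, wordDeriv (List.ofFn v) f x⟫_ℝ ≤
      2⁻¹ * (sobolevEnergy m Φ + sobolevEnergy m f) := by
  unfold sobolevEnergy wordEnergy
  rw [← Finset.sum_add_distrib, Finset.mul_sum]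
  refine Finset.sum_le_sum fun n _ => ?_
  rw [← Finset.sum_add_distrib, Finset.mul_sum]
  exact Finset.sum_le_sum fun v _ =>
    sobolev_aux_integral_inner_le (isSmooth_wordDeriv hΦ _) (isSmooth_wordDeriv hf _)

/-! ## Real analysis: sliding integrals from a dissipative differential inequality -/

/-- If `Y ≥ 0` is continuous on `[0, ∞)` with right derivative `Y' ≤ −ν G + K` at every `s ≥ 0` and
`G` is continuous on `[0, ∞)`, then `ν ∫ₜ^{t+1} G ≤ Y(t) + K` for every `t ≥ 0` (fencing theorem
for right derivatives against the barrier `Y(t) + ∫ₜ (−ν G + K)`). -/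
theorem sobolev_aux_integral_le_of_deriv_le {Y Y' G : ℝ → ℝ} {ν K t : ℝ}
    (hYc : ContinuousOn Y (Ici 0)) (hGc : ContinuousOn G (Ici 0))
    (hYd : ∀ s : ℝ, 0 ≤ s → HasDerivWithinAt Y (Y' s) (Ici s) s)
    (hineq : ∀ s : ℝ, 0 ≤ s → Y' s ≤ -ν * G s + K) (hY0 : ∀ s : ℝ, 0 ≤ s → 0 ≤ Y s) (ht : 0 ≤ t) :
    ν * ∫ s in t..t + 1, G s ≤ Y t + K := by
  have ht1 : t ≤ t + 1 := (lt_add_one t).le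
  have hgc : ContinuousOn (fun s => -ν * G s + K) (Ici 0) :=
    (continuousOn_const.mul hGc).add continuousOn_const
  set B : ℝ → ℝ := fun x => Y t + ∫ s in t..x, (-ν * G s + K) with hB
  have hsub : Icc t (t + 1) ⊆ Ici (0 : ℝ) := fun x hx => ht.trans hx.1
  have hBc : ContinuousOn B (Icc t (t + 1)) :=
    continuousOn_const.add (uniformGronwall_continuousOn_primitive hgc ht le_rfl ht1)
  have hBd : ∀ x ∈ Ico t (t + 1), HasDerivWithinAt B (-ν * G x + K) (Ici x) x := fun x hx =>
    (uniformGronwall_hasDerivWithinAt_primitive hgc ht hx.1).const_add (Y t)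
  have hYd' : ∀ x ∈ Ico t (t + 1), HasDerivWithinAt Y (Y' x) (Ici x) x := fun x hx =>
    hYd x (ht.trans hx.1)
  have hbound : ∀ x ∈ Ico t (t + 1), Y' x ≤ -ν * G x + K := fun x hx => hineq x (ht.trans hx.1)
  have hYB : Y t ≤ B t := by
    simp only [hB, intervalIntegral.integral_same, add_zero, le_refl]
  have key := image_le_of_deriv_right_le_deriv_boundary (hYc.mono hsub) hYd' hYB hBc hBd hbound
    (right_mem_Icc.mpr ht1)
  have hGi : IntervalIntegrable G volume t (t + 1) := uniformGronwall_intervalIntegrable hGc ht ht1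
  have hI : ∫ s in t..t + 1, (-ν * G s + K) = -ν * (∫ s in t..t + 1, G s) + K := by
    rw [intervalIntegral.integral_add (hGi.const_mul _) intervalIntegrable_const,
      intervalIntegral.integral_const_mul, intervalIntegral.integral_const, add_sub_cancel_left, one_smul]
  have h1 : Y (t + 1) ≤ Y t + (-ν * (∫ s in t..t + 1, G s) + K) := by
    have := key
    simp only [hB] at this
    rwa [hI] at this
  have h0 := hY0 (t + 1) (by linarith)
  linarith

end Summit.AnomalousDissipation.AnomalousDissipation.Theorems.ChainRealisation.SeparatrixFluxPinning

end
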